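import Literature.AlgebraicGeometry.Resolution.QuadraticTransformDeltaDrop
import Literature.AlgebraicGeometry.Resolution.NormalizationColengthBaseChange
import Literature.AlgebraicGeometry.Resolution.OneDimAnalyticallyUnramifiedReduced
import Literature.AlgebraicGeometry.Resolution.BlowupReducedDimension
import Literature.AlgebraicGeometry.Resolution.SecantSequenceLifts
import Mathlib.RingTheory.Nakayama
import HarnessLib

/-!
# Krull's blow-up tower: lemmas for the blow-up step (generators, chart algebra, transport)

Topic: `Literature/AlgebraicGeometry/Resolution`. The STEP of Kollár 2007, Thm. 1.101 (3) ⇒ (1)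
[Kru30, Satz 7] in the pointwise form of the named fact `Kollar2007_thm_1_101_localChain`
(`OneDimensionalBlowupTower.lean`): let `π : X' → X` be a blowing up along `D` with `D_x = 𝔪_x`,
where `S = 𝒪_{X,x}` is a reduced Noetherian local ring of dimension one with module-finite
normalization which is NOT regular, and `x' ∈ X'` a point over `x`. Then `S' = 𝒪_{X',x'}` is
again reduced, Noetherian, of dimension one with module-finite normalization, and
**`length_{S'}(S̄'/S') < length_S(S̄/S)`**. Assembly of the ring-theoretic files
`QuadraticTransform*.lean` with the chart dictionary `IsBlowup.exists_reesChart_stalk`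
(`BlowupStalkCharts.lean`): `S'` is the localization of the chart ring `S[𝔪/c] ≅ (S[𝔪t])_{(ct)}`
at a prime over `𝔪`, the generators of `𝔪` being chosen non-zero-divisors (prime avoidance for
the cosets `cᵢ + 𝔪²`, Davis), and the chart ring is realised inside the total ring of fractions.

* `exists_span_eq_maximalIdeal_forall_mem_nonZeroDivisors` — `𝔪` is generated by finitely many
  non-zero-divisors (reduced, dimension one);
* `exists_pow_mul_eq_of_mem_blowupAlgebra` — elements of `S[I/a]` are fractions `r/aⁿ`, `r ∈ Iⁿ`;
* `QuadraticTransform.isNoetherianRing`, `QuadraticTransform.one_le_ringKrullDim` — bookkeeping;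
* `isLocalizationAtPrime_comap_symm_of_ringEquiv` — transport of `IsLocalization.AtPrime` along
  a ring isomorphism of the base.
(The step itself is assembled in `OneDimensionalBlowupTowerStep.lean`.)

No definitions, no named facts. Sources: J. Kollár, *Lectures on Resolution of Singularities*
(2007), §1.13, Thm. 1.101, Lemma 1.99 [Kollar2007]; I. Kaplansky, *Commutative Rings*, Thm. 124
[Kaplansky1974]; The Stacks Project, Tag 0804 [StacksProject].
-/

noncomputable section

open IsLocalRing Polynomial nonZeroDivisors CategoryTheory AlgebraicGeometry
open Literature.RingTheory.HilbertSamuel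

namespace Literature.AlgebraicGeometry.Resolution

universe u

/-! ## Generators of `𝔪` which are non-zero-divisors -/

section Generators

/-- In a reduced Noetherian local ring of dimension one, the maximal ideal is generated by
finitely many NON-ZERO-DIVISORS: perturb any generators inside their cosets modulo `𝔪²` off the
(finitely many) minimal primes (prime avoidance for cosets, Davis / Kaplansky Thm. 124; no minimal
prime contains `𝔪²`), and use Nakayama's lemma. [cite: Kaplansky1974, Thm. 124] -/
theorem exists_span_eq_maximalIdeal_forall_mem_nonZeroDivisors (R : Type u) [CommRing R]
    [IsLocalRing R] [IsNoetherianRing R] [IsReduced R] (hdim : ringKrullDim R = 1) :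
    ∃ (k : ℕ) (c : Fin k → R), Ideal.span (Set.range c) = maximalIdeal R ∧ ∀ i, c i ∈ R⁰ := by
  classical
  obtain ⟨k, c₀, hc₀⟩ := Submodule.fg_iff_exists_fin_generating_family.mp
    (IsNoetherian.noetherian (maximalIdeal R))
  have hfin : (minimalPrimes R).Finite := minimalPrimes.finite_of_isNoetherianRing R
  obtain ⟨x, hxm, hx0⟩ := exists_mem_maximalIdeal_mem_nonZeroDivisors R hdim
  -- no minimal prime contains `𝔪²` (it would contain `𝔪`, hence the non-zero-divisor `x`)
  have hnot : ∀ K ∈ minimalPrimes R, ¬ maximalIdeal R ^ 2 ≤ K := by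
    intro K hK hle
    haveI : K.IsPrime := hK.1.1
    have hxK : x ∈ K := ‹K.IsPrime›.mem_of_pow_mem 2 (hle (Ideal.pow_mem_pow hxm 2))
    exact Set.disjoint_left.mp (Ideal.disjoint_nonZeroDivisors_of_mem_minimalPrimes hK) hxK hx0
  have hex : ∀ i : Fin k, ∃ a ∈ maximalIdeal R ^ 2, ∀ K ∈ minimalPrimes R, c₀ i + a ∉ K :=
    fun i => exists_add_mem_forall_notMem (maximalIdeal R ^ 2) (c₀ i) hfin
      (fun K hK => hK.1.1) (fun K hK _ => hnot K hK)
  choose a ha haK using hex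
  refine ⟨k, fun i => c₀ i + a i, ?_, fun i => ?_⟩
  · have hc₀mem : ∀ i, c₀ i ∈ maximalIdeal R := fun i =>
      hc₀ ▸ Ideal.subset_span ⟨i, rfl⟩
    apply le_antisymm
    · refine Ideal.span_le.mpr ?_
      rintro _ ⟨i, rfl⟩
      exact Ideal.add_mem _ (hc₀mem i) (Ideal.pow_le_self two_ne_zero (ha i))
    · -- Nakayama: `𝔪 ≤ (c) + 𝔪²`
      refine Submodule.le_of_le_smul_of_le_jacobson_bot (IsNoetherian.noetherian _)
        (IsLocalRing.maximalIdeal_le_jacobson ⊥) ?_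
      rw [← hc₀]
      refine Ideal.span_le.mpr ?_
      rintro _ ⟨i, rfl⟩
      have h1 : c₀ i = (c₀ i + a i) - a i := by ring
      rw [h1]
      refine Submodule.sub_mem _ (Ideal.mem_sup_left (Ideal.subset_span ⟨i, rfl⟩))
        (Ideal.mem_sup_right ?_)
      rw [Ideal.smul_eq_mul, hc₀, ← pow_two]
      exact ha i
  · by_contra h
    obtain ⟨q, hq, hcq⟩ := exists_mem_minimalPrimes_of_not_mem_nonZeroDivisors h
    exact haK i q hq hcq

end Generators


/-! ## Elements of the affine blowup algebra are fractions `r/aⁿ`, `r ∈ Iⁿ` -/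

section BlowupAlgebra

/-- Every element `y` of the affine blowup algebra `R[I/a] ⊆ R[1/a]` (`a ∈ I`) satisfies
`aⁿ y = r` for some `n` and `r ∈ Iⁿ` (Stacks 052Q: the elements of `R[I/a]` are "represented by
an expression of the form `x/aⁿ` with `x ∈ Iⁿ`"). [cite: StacksProject, Tag 052Q] -/
theorem exists_pow_mul_eq_of_mem_blowupAlgebra {R : Type u} [CommRing R] {I : Ideal R} {a : R}
    (ha : a ∈ I) {y : Localization.Away a} (hy : y ∈ blowupAlgebra I a) :
    ∃ n : ℕ, ∃ r ∈ I ^ n, algebraMap R (Localization.Away a) (a ^ n) * y =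
      algebraMap R (Localization.Away a) r := by
  change y ∈ Algebra.adjoin R (blowupAlgebraGens I a) at hy
  induction hy using Algebra.adjoin_induction with
  | mem y hy =>
    obtain ⟨x, hx, rfl⟩ := hy
    refine ⟨1, x, by rw [pow_one]; exact hx, ?_⟩
    rw [pow_one, mul_comm, div_mul_algebraMap]
  | algebraMap r =>
    exact ⟨0, r, by rw [pow_zero, Ideal.one_eq_top]; trivial, by rw [pow_zero, map_one, one_mul]⟩
  | add y z _ _ hy hz =>
    obtain ⟨n, r, hr, hy⟩ := hy
    obtain ⟨m, t, ht, hz⟩ := hz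
    refine ⟨n + m, r * a ^ m + t * a ^ n, ?_, ?_⟩
    · rw [pow_add]
      refine Ideal.add_mem _ (Ideal.mul_mem_mul hr (Ideal.pow_mem_pow ha m)) ?_
      rw [mul_comm (I ^ n)]
      exact Ideal.mul_mem_mul ht (Ideal.pow_mem_pow ha n)
    · rw [mul_add, map_add, map_mul, map_mul, ← hy, ← hz]
      simp only [pow_add, map_mul, map_pow]
      ring
  | mul y z _ _ hy hz =>
    obtain ⟨n, r, hr, hy⟩ := hy
    obtain ⟨m, t, ht, hz⟩ := hz
    refine ⟨n + m, r * t, by rw [pow_add]; exact Ideal.mul_mem_mul hr ht, ?_⟩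
    rw [map_mul, ← hy, ← hz]
    simp only [pow_add, map_mul, map_pow]
    ring

end BlowupAlgebra

namespace QuadraticTransform

variable {R : Type u} [CommRing R] [IsLocalRing R] [IsNoetherianRing R] [IsReduced R]
  {K : Type u} [CommRing K] [Algebra R K] [IsFractionRing R K]
  {B : Subalgebra R K} (𝔴 : Ideal B) [𝔴.IsPrime]
  (R' : Type u) [CommRing R'] [Algebra B R'] [IsLocalization.AtPrime R' 𝔴]
  [Algebra R R']
  (Q' : Type u) [CommRing Q'] [Algebra K Q']
  [IsLocalization (𝔴.primeCompl.map (algebraMap B K)) Q']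
  [Algebra R' Q'] [Algebra R Q'] [IsScalarTower B R' Q'] [IsScalarTower R K Q']
  [IsScalarTower R R' Q']

include 𝔴 R' Q'

/-! ## Bookkeeping: `R'` is a Noetherian local ring of dimension `≥ 1` -/

omit Q' [IsLocalization (𝔴.primeCompl.map (algebraMap B K)) Q'] [Algebra R Q']
  [IsScalarTower B R' Q'] [IsScalarTower R K Q'] [IsScalarTower R R' Q'] [CommRing Q']
  [Algebra K Q'] [Algebra R' Q'] [IsLocalRing R] [IsNoetherianRing R] [IsReduced R]
  [IsFractionRing R K] [Algebra R R'] in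
/-- `R' = B_𝔴` is Noetherian when `B` is. [cite: Kollar2007, Thm. 1.101] -/
theorem isNoetherianRing [IsNoetherianRing B] : IsNoetherianRing R' :=
  IsLocalization.isNoetherianRing 𝔴.primeCompl R' inferInstance

omit [IsLocalRing R] [IsNoetherianRing R] [IsReduced R] in
/-- `dim R' ≥ 1`: the maximal ideal of `R' = B_𝔴` contains the non-zero-divisor `c` (as `𝔴`
lies over `𝔪 ∋ c`), so it is not a minimal prime. [cite: Kollar2007, Thm. 1.101] -/
theorem one_le_ringKrullDim [IsScalarTower R B R'] {c : R} (hc0 : c ∈ R⁰)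
    (hc𝔴 : algebraMap R B c ∈ 𝔴) : 1 ≤ ringKrullDim R' := by
  haveI : IsLocalRing R' := IsLocalization.AtPrime.isLocalRing R' 𝔴
  -- `c` is a non-zero-divisor of `R'` in its maximal ideal
  have hcR' : algebraMap R R' c ∈ maximalIdeal R' := by
    rw [IsScalarTower.algebraMap_apply R B R']
    exact (IsLocalization.AtPrime.to_map_mem_maximal_iff R' 𝔴 _).mpr hc𝔴
  have hc0' : algebraMap R R' c ∈ R'⁰ := by
    rw [mem_nonZeroDivisors_iff_right]
    intro x hx
    apply algebraMap_injective 𝔴 R' Q'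
    rw [map_zero]
    have h1 : algebraMap R' Q' x * algebraMap R' Q' (algebraMap R R' c) = 0 := by
      rw [← map_mul, hx, map_zero]
    rw [← IsScalarTower.algebraMap_apply] at h1
    exact (isUnit_algebraMap_of_mem_nonZeroDivisors R K Q' c hc0).mul_left_eq_zero.mp h1
  have hnot : maximalIdeal R' ∉ minimalPrimes R' := fun hmin =>
    Set.disjoint_left.mp (Ideal.disjoint_nonZeroDivisors_of_mem_minimalPrimes hmin) hcR' hc0'
  have hh : (maximalIdeal R').height ≠ 0 := fun h0 => hnot (Ideal.height_eq_zero_iff.mp h0)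
  rw [← IsLocalRing.maximalIdeal_height_eq_ringKrullDim]
  have : (1 : ℕ∞) ≤ (maximalIdeal R').height := Order.one_le_iff_pos.mpr (pos_iff_ne_zero.mpr hh)
  exact_mod_cast this


end QuadraticTransform


/-! ## Transport of a localization at a prime along a ring isomorphism -/

section Transport

/-- If `S'` is the localization of `C` at the prime `P` and `e : C ≃+* B`, then `S'` (with the
structure map `B ≅ C → S'`) is the localization of `B` at `e(P) = e.symm⁻¹(P)`.
[cite: Kollar2007, Thm. 1.101] -/
theorem isLocalizationAtPrime_comap_symm_of_ringEquiv {C B : Type u} [CommRing C] [CommRing B]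
    (e : C ≃+* B) (P : Ideal C) [P.IsPrime] (S' : Type u) [CommRing S'] [Algebra C S']
    [IsLocalization.AtPrime S' P] [Algebra B S'] [(P.comap e.symm.toRingHom).IsPrime]
    (halg : ∀ b : B, algebraMap B S' b = algebraMap C S' (e.symm b)) :
    IsLocalization.AtPrime S' (P.comap e.symm.toRingHom) := by
  have hinst : (‹Algebra B S'› : Algebra B S') =
      ((algebraMap C S').comp e.symm.toRingHom).toAlgebra :=
    Algebra.algebra_ext _ _ fun b => by rw [halg]; rfl
  have hMeq : (P.comap e.symm.toRingHom).primeCompl = P.primeCompl.map e.toMonoidHom := by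
    ext y
    simp only [Ideal.mem_primeCompl_iff, Ideal.mem_comap, RingEquiv.toRingHom_eq_coe,
      RingEquiv.coe_toRingHom, Submonoid.mem_map]
    constructor
    · intro hy
      exact ⟨e.symm y, hy, e.apply_symm_apply y⟩
    · rintro ⟨z, hz, rfl⟩
      change e.symm (e z) ∉ P
      rwa [e.symm_apply_apply]
  have h := IsLocalization.isLocalization_of_base_ringEquiv P.primeCompl S' e
  change IsLocalization (P.comap e.symm.toRingHom).primeCompl S'
  rw [hMeq, hinst]
  exact h

end Transport

end Literature.AlgebraicGeometry.Resolution

end
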